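import Summits.KontsevichZagierPeriods.KontsevichZagierPeriods.Theorems.SymplecticScissorsRealOnePeriodRelationsStubSaHomotopicAux3

/-!
# Stub `stub_saHomotopic` of crux `SymplecticScissors.RealOnePeriodRelations`
# (stmt-KontsevichZagierPeriods-10042, line `nash-retraction-thin-strip`)

**Semialgebraic representatives of homotopy classes.** For a smooth affine curve `Z` over `ℚ̄` and
an arbitrary `C¹` path `γ` on `Z(ℂ)` with algebraic end points there is a `ℚ`-semialgebraic `C¹`
path `γ'` on `Z` (a `CurvePath`) homotopic to `γ` with fixed end points inside `Z(ℂ)`, granted the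
hypothesis of the stub that continuous paths inside an open `G ⊆ ℂⁿ` with algebraic end points can be
replaced by semialgebraic `C¹` paths inside `G` (`stub_saPathSubset` of the skeleton).

* `exists_saData` — the data (`SaData`, files `…Aux2/3`): chart regions covering `γ` (the tree's
  `exists_localChart`, Lebesgue number), algebraic break points `b_r` near `γ(r/N)`
  (`exists_algebraicPoint_mem`) so close that the chart-straight link `λ_r` from `γ(r/N)` to `b_r`
  stays in both adjacent chart regions, and the semialgebraic pieces `σ_r` from the hypothesis
  applied to the chart-straight segment from `b_r` to `b_{r+1}` inside `Ω_r`;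
* `stub_saHomotopic` — the registered signature, by `exists_saData` and `SaData.assemble`.

References: A. Huber, G. Wüstholz, *Transcendence and Linear Relations of 1-Periods* (CUP 2022),
§3.3.1 ("up to homotopy such a cycle can be replaced by …"); J. Bochnak, M. Coste, M.-F. Roy,
*Real Algebraic Geometry* (1998), §2.2.
-/

noncomputable section

open scoped BigOperators Topology unitInterval
open Set Filter Metric MvPolynomial
open Literature.NumberTheory.Transcendental Literature.NumberTheory.Transcendental.CurvePeriods
open Literature.ModelTheory.ExponentialFields (IsSemialgebraic)

namespace Summit.KontsevichZagierPeriods.SymplecticScissors.RealOnePeriodRelations.SaHomotopic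

variable {Z : CurveData}

/-! ### Existence of the data -/

/-- **Existence of the data.** Given the semialgebraic-path hypothesis of the stub (continuous
paths inside an open `G` with algebraic end points are replaced by semialgebraic `C¹` paths inside
`G`), every `C¹` path `γ` on a smooth affine `Z` admits `SaData`: chart regions from
`exists_localChart` and a Lebesgue number, algebraic break points near `γ(r/N)`
(`exists_algebraicPoint_mem`) so close that the chart-straight link stays in both adjacent regions,
and the pieces `σ_r` from the hypothesis applied to the chart-straight segment from `b_r` to
`b_{r+1}` inside `Ω_r`. [cite: HuberWustholz2022, §3.3.1] -/
theorem exists_saData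
    (hps : ∀ (Z : CurveData), Z.IsSmoothAffineCurve → ∀ (G : Set (Fin Z.n → ℂ)), IsOpen G →
      ∀ (e : ℝ → (Fin Z.n → ℂ)), ContinuousOn e (Set.Icc 0 1) →
        (∀ t ∈ Set.Icc (0 : ℝ) 1, e t ∈ Z.points) → (∀ t ∈ Set.Icc (0 : ℝ) 1, e t ∈ G) →
        (∀ i, IsAlgebraic ℚ (e 0 i)) → (∀ i, IsAlgebraic ℚ (e 1 i)) →
      ∃ γ : CurvePath Z,
        IsSemialgebraicMapOn ℚ {z : Fin 1 → ℝ | z 0 ∈ Set.Icc (0 : ℝ) 1}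
          (fun z => Fin.append (fun i => (γ.toFun (z 0) i).re) (fun i => (γ.toFun (z 0) i).im)) ∧
        γ.toFun 0 = e 0 ∧ γ.toFun 1 = e 1 ∧ ∀ t ∈ Set.Icc (0 : ℝ) 1, γ.toFun t ∈ G)
    (hZ : Z.IsSmoothAffineCurve) (γ : CurvePath Z) : Nonempty (SaData Z γ) := by
  classical
  have hI0 : (0 : ℝ) ∈ Icc (0 : ℝ) 1 := ⟨le_rfl, zero_le_one⟩
  have hI1 : (1 : ℝ) ∈ Icc (0 : ℝ) 1 := ⟨zero_le_one, le_rfl⟩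
  -- the path as a continuous map on `ℝ`
  set P : ℝ → (Fin Z.n → ℂ) := pext γ with hPdef
  have hPc : Continuous P := continuous_pext γ
  have hPZ : ∀ t, P t ∈ Z.points := pext_mem γ
  have hP0 : P 0 = γ.toFun 0 := pext_of_mem γ hI0
  have hP1 : P 1 = γ.toFun 1 := pext_of_mem γ hI1
  -- charts at the points of `Z`
  have hch : ∀ z, z ∈ Z.points → ∃ (i₀ : Fin Z.n) (ε : ℝ) (Ω : Set (Fin Z.n → ℂ))
      (ψ : ℂ → (Fin Z.n → ℂ)), 0 < ε ∧ IsOpen Ω ∧ z ∈ Ω ∧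
      AnalyticOnNhd ℂ ψ (ball (z i₀) ε) ∧
      (∀ z' ∈ Ω, z' ∈ Z.points → z' i₀ ∈ ball (z i₀) ε ∧ ψ (z' i₀) = z') ∧
      (∀ w ∈ ball (z i₀) ε, ψ w ∈ Ω ∧ ψ w ∈ Z.points ∧ ψ w i₀ = w) :=
    fun z hz => hZ.exists_localChart hz
  haveI : Nonempty (Fin Z.n) := ⟨⟨0, Nat.pos_of_ne_zero (n_ne_zero_of_mem hZ (hPZ 0))⟩⟩
  choose! ic εc Ωc ψc _ hΩo hzΩ hψc h1c h2c using hch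
  -- Lebesgue number for the cover of `[0,1]` by the preimages of the chart domains
  have hcov : ∀ s : Icc (0 : ℝ) 1, ∃ U : Set ℝ, IsOpen U ∧ (s : ℝ) ∈ U ∧
      ∀ t ∈ U, P t ∈ Ωc (P s) := fun s =>
    ⟨P ⁻¹' Ωc (P s), (hΩo _ (hPZ s)).preimage hPc, hzΩ _ (hPZ s), fun _ ht => ht⟩
  choose U hUo hsU hU using hcov
  obtain ⟨δ, hδ, hleb⟩ := lebesgue_number_lemma_of_metric isCompact_Icc hUo
    (fun t ht => mem_iUnion.mpr ⟨⟨t, ht⟩, hsU ⟨t, ht⟩⟩)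
  obtain ⟨N₀, hN₀⟩ := exists_nat_one_div_lt hδ
  set N : ℕ := N₀ + 1 with hN
  have hNpos : 0 < N := Nat.succ_pos N₀
  have hN' : (0 : ℝ) < N := by exact_mod_cast hNpos
  have hNinv : 1 / (N : ℝ) < δ := by rw [hN]; exact_mod_cast hN₀
  have htI : ∀ r : ℕ, r ≤ N → (r : ℝ) / N ∈ Icc (0 : ℝ) 1 := fun r hr =>
    ⟨by positivity, (div_le_one hN').mpr (by exact_mod_cast hr)⟩
  have hidx : ∀ r : ℕ, r < N → ∃ s : Icc (0 : ℝ) 1,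
      ∀ t ∈ Icc ((r : ℝ) / N) (((r : ℝ) + 1) / N), P t ∈ Ωc (P s) := by
    intro r hr
    obtain ⟨s, hs⟩ := hleb ((r : ℝ) / N) (htI r hr.le)
    refine ⟨s, fun t ht => hU s t (hs ?_)⟩
    rw [mem_ball, Real.dist_eq, abs_lt]
    have h1 : t - r / N ≤ 1 / N := by have := ht.2; rw [add_div] at this; linarith
    exact ⟨by linarith [sub_nonneg.mpr ht.1], by linarith⟩
  choose! sc hsc using hidx
  -- chart data of piece `r`
  set c : ℕ → (Fin Z.n → ℂ) := fun r => P (sc r) with hc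
  have hcZ : ∀ r, c r ∈ Z.points := fun r => hPZ _
  set i : ℕ → Fin Z.n := fun r => ic (c r) with hi
  set T : ℕ → Set ℂ := fun r => ball (c r (i r)) (εc (c r)) with hT
  set ψ : ℕ → ℂ → (Fin Z.n → ℂ) := fun r => ψc (c r) with hψ
  set Ω : ℕ → Set (Fin Z.n → ℂ) := fun r => Ωc (c r) with hΩ
  have hTc : ∀ r, Convex ℝ (T r) := fun r => convex_ball _ _
  have hψcont : ∀ r, ContinuousOn (ψ r) (T r) := fun r => (hψc _ (hcZ r)).continuousOn
  have hΩop : ∀ r, IsOpen (Ω r) := fun r => hΩo _ (hcZ r)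
  have h1 : ∀ r, ∀ z ∈ Ω r, z ∈ Z.points → z (i r) ∈ T r ∧ ψ r (z (i r)) = z :=
    fun r z hz hzZ => h1c _ (hcZ r) z hz hzZ
  have h2 : ∀ r, ∀ w ∈ T r, ψ r w ∈ Ω r ∧ ψ r w ∈ Z.points :=
    fun r w hw => ⟨(h2c _ (hcZ r) w hw).1, (h2c _ (hcZ r) w hw).2.1⟩
  have hPΩ : ∀ r, r < N → ∀ t ∈ Icc ((r : ℝ) / N) (((r : ℝ) + 1) / N), P t ∈ Ω r :=
    fun r hr t ht => hsc r hr t ht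
  -- end points of the pieces
  have hleftΩ : ∀ r, r < N → P ((r : ℝ) / N) ∈ Ω r := fun r hr =>
    hPΩ r hr _ ⟨le_rfl, div_le_succ_div N r⟩
  have hcastp : ∀ r : ℕ, 0 < r → (((r - 1 : ℕ) : ℝ) + 1) / N = (r : ℝ) / N := fun r hr => by
    rw [Nat.cast_pred hr, sub_add_cancel]
  have hprevI : ∀ r : ℕ, 0 < r → (r : ℝ) / N ∈
      Icc (((r - 1 : ℕ) : ℝ) / N) ((((r - 1 : ℕ) : ℝ) + 1) / N) := fun r hr => by
    rw [hcastp r hr]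
    exact ⟨div_le_div_of_nonneg_right (by exact_mod_cast Nat.sub_le r 1) hN'.le, le_rfl⟩
  have hprevΩ : ∀ r, r ≤ N → P ((r : ℝ) / N) ∈ Ω (r - 1) := by
    intro r hr
    rcases Nat.eq_zero_or_pos r with h0 | hpos
    · subst h0
      exact hleftΩ 0 hNpos
    · exact hPΩ (r - 1) (by omega) _ (hprevI r hpos)
  -- the middle break points
  have hmid : ∀ r, 0 < r → r < N → ∃ bb : Fin Z.n → ℂ, bb ∈ Z.points ∧
      (∀ j, IsAlgebraic ℚ (bb j)) ∧ bb ∈ Ω (r - 1) ∧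
      ∀ v ∈ Icc (0 : ℝ) 1,
        ψ (r - 1) (segPoint (P ((r : ℝ) / N) (i (r - 1))) (bb (i (r - 1))) v) ∈ Ω r := by
    intro r hr0 hrN
    have hw₀ := h1 (r - 1) _ (hprevΩ r hrN.le) (hPZ _)
    set w₀ : ℂ := P ((r : ℝ) / N) (i (r - 1)) with hw₀def
    have hWo : IsOpen (T (r - 1) ∩ ψ (r - 1) ⁻¹' Ω r) :=
      (hψcont (r - 1)).isOpen_inter_preimage isOpen_ball (hΩop r)
    have hw₀W : w₀ ∈ T (r - 1) ∩ ψ (r - 1) ⁻¹' Ω r :=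
      ⟨hw₀.1, by rw [mem_preimage, hw₀.2]; exact hleftΩ r hrN⟩
    obtain ⟨η, hη, hball⟩ := Metric.isOpen_iff.mp hWo w₀ hw₀W
    have hUo : IsOpen ({z : Fin Z.n → ℂ | z (i (r - 1)) ∈ ball w₀ η} ∩ Ω (r - 1)) :=
      ((isOpen_ball (x := w₀) (ε := η)).preimage (continuous_apply (i (r - 1)))).inter (hΩop _)
    obtain ⟨bb, hbbU, hbbZ, hbbalg⟩ := hZ.exists_algebraicPoint_mem (hPZ ((r : ℝ) / N)) hUo
      ⟨mem_ball_self hη, hprevΩ r hrN.le⟩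
    refine ⟨bb, hbbZ, hbbalg, hbbU.2, fun v hv => ?_⟩
    exact (hball (segPoint_mem (convex_ball _ _) (mem_ball_self hη) hbbU.1 hv)).2
  choose! bmid hbmidZ hbmidalg hbmidΩ hbmidseg using hmid
  -- the break points and the links
  set b : ℕ → (Fin Z.n → ℂ) := fun r => if r = 0 then P 0 else if r = N then P 1 else bmid r
    with hb
  have hb0 : b 0 = γ.toFun 0 := by simp [hb, hP0]
  have hbN : b N = γ.toFun 1 := by simp [hb, hNpos.ne', hP1]
  have hbm : ∀ r, 0 < r → r < N → b r = bmid r := fun r hr0 hrN => by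
    simp only [hb, if_neg hr0.ne', if_neg hrN.ne]
  have hbNP : b N = P ((N : ℝ) / N) := by rw [div_self hN'.ne', hbN, hP1]
  have hbprev : ∀ r, r ≤ N → b r ∈ Ω (r - 1) ∧ b r ∈ Z.points := by
    intro r hr
    rcases Nat.eq_zero_or_pos r with h0 | hpos
    · subst h0
      rw [hb0, ← hP0]
      exact ⟨by simpa using hleftΩ 0 hNpos, hPZ 0⟩
    rcases lt_or_eq_of_le hr with hlt | rfl
    · rw [hbm r hpos hlt]
      exact ⟨hbmidΩ r hpos hlt, hbmidZ r hpos hlt⟩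
    · rw [hbNP]
      exact ⟨hprevΩ _ le_rfl, hPZ _⟩
  have hbalg : ∀ r, r ≤ N → ∀ j, IsAlgebraic ℚ (b r j) := by
    intro r hr j
    rcases Nat.eq_zero_or_pos r with h0 | hpos
    · subst h0; rw [hb0]; exact γ.algebraic_zero j
    rcases lt_or_eq_of_le hr with hlt | rfl
    · rw [hbm r hpos hlt]; exact hbmidalg r hpos hlt j
    · rw [hbN]; exact γ.algebraic_one j
  have hbnext : ∀ r, r < N → b r ∈ Ω r ∧ b r ∈ Z.points := by
    intro r hr
    rcases Nat.eq_zero_or_pos r with h0 | hpos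
    · subst h0
      rw [hb0, ← hP0]
      exact ⟨by simpa using hleftΩ 0 hNpos, hPZ 0⟩
    · refine ⟨?_, (hbprev r hr.le).2⟩
      have h := hbmidseg r hpos hr 1 hI1
      rwa [segPoint_one, ← hbm r hpos hr,
        (h1 (r - 1) _ (hbprev r hr.le).1 (hbprev r hr.le).2).2] at h
  set lam : ℕ → ℝ → (Fin Z.n → ℂ) := fun r => link (ψ (r - 1)) (i (r - 1)) (P ((r : ℝ) / N)) (b r)
    with hlam
  have haT : ∀ r, r ≤ N → P ((r : ℝ) / N) (i (r - 1)) ∈ T (r - 1) ∧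
      ψ (r - 1) (P ((r : ℝ) / N) (i (r - 1))) = P ((r : ℝ) / N) := fun r hr =>
    h1 (r - 1) _ (hprevΩ r hr) (hPZ _)
  have hbT : ∀ r, r ≤ N → b r (i (r - 1)) ∈ T (r - 1) ∧ ψ (r - 1) (b r (i (r - 1))) = b r :=
    fun r hr => h1 (r - 1) _ (hbprev r hr).1 (hbprev r hr).2
  have hlamc : ∀ r, r ≤ N → Continuous (lam r) := fun r hr =>
    continuous_link (hTc _) (hψcont _) (haT r hr).1 (hbT r hr).1
  have hlam0 : ∀ r, r ≤ N → lam r 0 = P ((r : ℝ) / N) := fun r hr => by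
    simp only [hlam, link_zero, (haT r hr).2]
  have hlam1 : ∀ r, r ≤ N → lam r 1 = b r := fun r hr => by
    simp only [hlam, link_one, (hbT r hr).2]
  have hlam00 : ∀ v, lam 0 v = γ.toFun 0 := fun v => by
    have h : P (((0 : ℕ) : ℝ) / N) = b 0 := by rw [Nat.cast_zero, zero_div, hb0, hP0]
    simp only [hlam]
    rw [h, link_self (hbT 0 (Nat.zero_le N)).2, hb0]
  have hlamNN : ∀ v, lam N v = γ.toFun 1 := fun v => by
    simp only [hlam]
    rw [← hbNP, link_self (hbT N le_rfl).2, hbN]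
  have hlamZ : ∀ r, r ≤ N → ∀ v, lam r v ∈ Ω (r - 1) ∧ lam r v ∈ Z.points := fun r hr v =>
    link_mem (S := Ω (r - 1) ∩ Z.points) (hTc _) (fun w hw => h2 _ w hw) (haT r hr).1 (hbT r hr).1 v
  have hlamΩ : ∀ r, r < N → ∀ v, lam r v ∈ Ω r ∧ lam r v ∈ Z.points := by
    intro r hr v
    refine ⟨?_, (hlamZ r hr.le v).2⟩
    rcases Nat.eq_zero_or_pos r with h0 | hpos
    · subst h0
      rw [hlam00, ← hP0]
      simpa using hleftΩ 0 hNpos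
    · have h := hbmidseg r hpos hr (clamp01 v) (clamp01_mem v)
      rw [← hbm r hpos hr] at h
      exact h
  have hlamΩ' : ∀ r, r < N → ∀ v, lam (r + 1) v ∈ Ω r ∧ lam (r + 1) v ∈ Z.points :=
    fun r hr v => hlamZ (r + 1) (Nat.succ_le_of_lt hr) v
  -- the semialgebraic pieces
  have hsg : ∀ r, r < N → ∃ sg : CurvePath Z,
      IsSemialgebraicMapOn ℚ {z : Fin 1 → ℝ | z 0 ∈ Set.Icc (0 : ℝ) 1}
        (fun z => Fin.append (fun i => (sg.toFun (z 0) i).re) (fun i => (sg.toFun (z 0) i).im)) ∧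
      sg.toFun 0 = b r ∧ sg.toFun 1 = b (r + 1) ∧ ∀ t ∈ Icc (0 : ℝ) 1, sg.toFun t ∈ Ω r := by
    intro r hr
    have hbr := h1 r _ (hbnext r hr).1 (hbnext r hr).2
    have hbr' := h1 r _ (hbprev (r + 1) (Nat.succ_le_of_lt hr)).1
      (hbprev (r + 1) (Nat.succ_le_of_lt hr)).2
    set e : ℝ → (Fin Z.n → ℂ) := fun u => ψ r (segPoint (b r (i r)) (b (r + 1) (i r)) u) with he
    have hemem : ∀ u ∈ Icc (0 : ℝ) 1, segPoint (b r (i r)) (b (r + 1) (i r)) u ∈ T r :=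
      fun u hu => segPoint_mem (hTc r) hbr.1 hbr'.1 hu
    have hec : ContinuousOn e (Icc 0 1) :=
      (hψcont r).comp (contDiff_segPoint _ _ (n := 0)).continuous.continuousOn hemem
    have he0 : e 0 = b r := by simp only [he, segPoint_zero, hbr.2]
    have he1 : e 1 = b (r + 1) := by simp only [he, segPoint_one, hbr'.2]
    obtain ⟨sg, hsa, h0, h1', hG⟩ := hps Z hZ (Ω r) (hΩop r) e hec
      (fun u hu => (h2 r _ (hemem u hu)).2) (fun u hu => (h2 r _ (hemem u hu)).1)
      (fun j => by rw [he0]; exact hbalg r hr.le j)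
      (fun j => by rw [he1]; exact hbalg (r + 1) (Nat.succ_le_of_lt hr) j)
    exact ⟨sg, hsa, h0.trans he0, h1'.trans he1, hG⟩
  haveI : Nonempty (CurvePath Z) := ⟨γ⟩
  choose! sg hsgsa hsg0 hsg1 hsgΩ using hsg
  exact ⟨⟨N, hNpos, Ω, T, ψ, i, hTc, hψcont, h1, h2, hPΩ, b, hb0, hbN, hbalg, lam, hlamc, hlam0,
    hlam1, hlam00, hlamNN, hlamΩ, hlamΩ', sg, hsgsa, hsg0, hsg1, hsgΩ⟩⟩

end SaHomotopic

open SaHomotopic in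
/-- STUB `stub_saHomotopic` (landed). **Semialgebraic representatives of homotopy classes**: given
semialgebraic charts (first hypothesis, not used: the tree's `exists_localChart` suffices for the
homotopy) and the replacement of continuous paths inside an open set by semialgebraic `C¹` paths
inside it (second hypothesis, `stub_saPathSubset`), every `C¹` path `γ` on a smooth affine `Z` with
algebraic end points is homotopic with fixed end points, inside `Z(ℂ)`, to a `ℚ`-semialgebraic
`C¹` path `γ'`: cover `γ` by chart regions (Lebesgue number), move the break points `γ(r/N)` to
nearby algebraic points `b_r` along chart-straight links, replace `λ_r⁻¹ ⋆ γ_r ⋆ λ_{r+1}` inside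
the `r`-th chart region by a semialgebraic `C¹` piece `σ_r` from `b_r` to `b_{r+1}`, concatenate
with the flat cubic `φ(s) = 3s² − 2s³` (`γ' = b₀ + Σ_r (σ_r(φ(N t − r)) − b_r)`, `C¹` and
semialgebraic), and build the homotopy explicitly: `γ ≃ γ ∘ f` (reparametrisation),
`γ ∘ f ≃ Π_r (λ_r⁻¹ ⋆ γ_r ⋆ λ_{r+1})` (links inserted progressively), and piecewise chart-straight
homotopies onto `γ'`. [cite: HuberWustholz2022, §3.3.1] -/
theorem stub_saHomotopic :
    (∀ (Z : CurveData), Z.IsSmoothAffineCurve → ∀ z₀ ∈ Z.points,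
      ∃ (i₀ : Fin Z.n) (c : ℂ) (ε ρ : ℝ) (Ω : Set (Fin Z.n → ℂ)) (ψ : ℂ → (Fin Z.n → ℂ)),
        0 < ρ ∧ ρ < ε ∧ IsOpen Ω ∧ z₀ ∈ Ω ∧ z₀ i₀ ∈ Metric.ball c (ρ / 6) ∧ AnalyticOnNhd ℂ ψ (Metric.ball c ε) ∧
        (∀ z ∈ Ω, z ∈ Z.points → z i₀ ∈ Metric.ball c ε ∧ ψ (z i₀) = z) ∧
        (∀ w ∈ Metric.ball c ε, ψ w ∈ Ω ∧ ψ w ∈ Z.points ∧ ψ w i₀ = w) ∧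
        IsSemialgebraicMapOn ℚ {q : Fin 2 → ℝ | (⟨q 0, q 1⟩ : ℂ) ∈ Metric.closedBall c ρ}
          (fun q => Fin.append (fun i => (ψ ⟨q 0, q 1⟩ i).re) (fun i => (ψ ⟨q 0, q 1⟩ i).im))) →
    (∀ (Z : CurveData), Z.IsSmoothAffineCurve → ∀ (G : Set (Fin Z.n → ℂ)), IsOpen G →
      ∀ (e : ℝ → (Fin Z.n → ℂ)), ContinuousOn e (Set.Icc 0 1) →
        (∀ t ∈ Set.Icc (0 : ℝ) 1, e t ∈ Z.points) → (∀ t ∈ Set.Icc (0 : ℝ) 1, e t ∈ G) →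
        (∀ i, IsAlgebraic ℚ (e 0 i)) → (∀ i, IsAlgebraic ℚ (e 1 i)) →
      ∃ γ : CurvePath Z,
        IsSemialgebraicMapOn ℚ {z : Fin 1 → ℝ | z 0 ∈ Set.Icc (0 : ℝ) 1}
          (fun z => Fin.append (fun i => (γ.toFun (z 0) i).re) (fun i => (γ.toFun (z 0) i).im)) ∧
        γ.toFun 0 = e 0 ∧ γ.toFun 1 = e 1 ∧ ∀ t ∈ Set.Icc (0 : ℝ) 1, γ.toFun t ∈ G) →
    ∀ (Z : CurveData), Z.IsSmoothAffineCurve → ∀ γ : CurvePath Z, ∃ γ' : CurvePath Z,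
      IsSemialgebraicMapOn ℚ {z : Fin 1 → ℝ | z 0 ∈ Set.Icc (0 : ℝ) 1}
        (fun z => Fin.append (fun i => (γ'.toFun (z 0) i).re) (fun i => (γ'.toFun (z 0) i).im)) ∧
      ∃ (x y : Z.points) (p p' : Path x y), (∀ t : I, γ.toFun t = p t) ∧ (∀ t : I, γ'.toFun t = p' t) ∧
        p.Homotopic p' := by
  intro _ hps Z hZ γ
  obtain ⟨D⟩ := exists_saData hps hZ γ
  exact D.assemble

end Summit.KontsevichZagierPeriods.SymplecticScissors.RealOnePeriodRelations

end
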